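import Mathlib
import Literature.Computability.Complexity.CircuitAdderMultiplier

/-!
# `RazTransfer` (stmt-ValiantsHypothesis-8497), part 1 — the exponent bits of the binomial
curve by a polynomial-size `B₂`-circuit

Route `BinomialElusive` of `ValiantsHypothesis`, item `RazTransfer`: the binomial curve
`x ↦ (x^{E(2i+1)} + x^{E(2i+2)})_{i<m}` with `E(j) = Σ_{k ≤ h} (j · M)^k`, `h = ⌊log₂ m⌋²`,
`M = (2m+2)^{h+1}`, must be shown *explicit* in Raz's sense (Raz 2010, Def. 1.3: the
multilinearised family is poly(`n`)-definable). By Valiant's criterion this reduces to computing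
the low `n` bits of `E(2i+1+c)` from the bits of `i` and a selector bit `c` by a `B₂`-circuit of
size poly(`n`) ("school arithmetic"). This file builds that circuit in the straight-line
framework `CktSize` of `Literature.Computability.Complexity.CircuitComposition`, from the
ripple-carry adder and the schoolbook multiplier of `CircuitAdderMultiplier.lean`:

* `lowBits n V` — the low `n` bits of a number-valued function `V` of the inputs (an `n`-bit
  register, arithmetic mod `2ⁿ`); closure of `CktSize B2 (lowBits n ·) ·` under `a · b + d`
  (`cktSize_lowBits_ma`, one multiplier and one adder), constants, input blocks;
* `cktSize_lowBits_geomSum` — Horner's rule: `Σ_{k<t} Y^k` costs `t` multiply–add blocks;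
* `cktSize_lowBits_expo` — the exponent `E_m(2i+1+c)` (`expo m (2 i + 1 + c)`) from the bits
  of `i` and `c`, with `expSize m n ≤ 2400 (⌊log₂ m⌋² + 1)(n+1)²` gates (`expSize_le`);
* `mFn`, `curve`, `expBits` — the re-indexing `m(n) = 2^{⌊log₂ n⌋²}`, the route's binomial
  curve at arity `m(n)` in `ℂ[x]`, and its exponent-bit map (definitions for the assembly).

References: R. Raz, *Elusive functions and lower bounds for arithmetic circuits*, Theory of
Computing 6 (2010), Def. 1.3 and the remark following it; H. Vollmer, *Introduction to Circuit
Complexity* (1999), §1.1, §1.3.2 (school methods); P. Bürgisser, *Completeness and Reduction in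
Algebraic Complexity Theory* (2000), Prop. 2.20 (Valiant's criterion).
-/

set_option linter.dupNamespace false

namespace Summit.ValiantsHypothesis.ValiantsHypothesis.Theorems.BinomialElusiveRazTransfer

open Literature.Computability.Complexity Literature.Computability.Complexity.ArithCkt

variable {ι : Type*}

/-! ### Registers: number-valued functions of the inputs, read through their low `n` bits -/

/-- The `n`-bit register of a number-valued function of the inputs: `lowBits n V x l` is bit
`l < n` of `V x` (so the register holds `V x mod 2ⁿ`). -/
def lowBits (n : ℕ) (V : (ι → Bool) → ℕ) : (ι → Bool) → Fin n → Bool := fun x l => (V x).testBit l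

/-- Below `n`, the bits of a number only depend on its residue mod `2ⁿ`. -/
theorem testBit_eq_of_modEq {n a b : ℕ} (h : a ≡ b [MOD 2 ^ n]) {l : ℕ} (hl : l < n) :
    a.testBit l = b.testBit l := by
  have ha := Nat.testBit_mod_two_pow a n l
  have hb := Nat.testBit_mod_two_pow b n l
  rw [Nat.ModEq] at h
  rw [h, hb, decide_eq_true hl, Bool.true_and, Bool.true_and] at ha
  exact ha.symm

/-- A register only sees its value mod `2ⁿ`. -/
theorem cktSize_lowBits_congr_modEq {n s : ℕ} {V V' : (ι → Bool) → ℕ}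
    (h : CktSize B2 (lowBits n V) s) (hV : ∀ x, V x ≡ V' x [MOD 2 ^ n]) :
    CktSize B2 (lowBits n V') s :=
  h.congr fun x l => testBit_eq_of_modEq (hV x) l.isLt

/-- Extensionally equal values give the same register. -/
theorem cktSize_lowBits_congr {n s : ℕ} {V V' : (ι → Bool) → ℕ} (h : CktSize B2 (lowBits n V) s)
    (hV : ∀ x, V x = V' x) : CktSize B2 (lowBits n V') s :=
  cktSize_lowBits_congr_modEq h fun x => by rw [hV x]

/-- A constant register costs two gates (the constants `0` and `1`, routed to the bit
positions). -/
theorem cktSize_lowBits_const (ι : Type*) (n c : ℕ) :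
    CktSize B2 (lowBits n fun _ : ι → Bool => c) 2 := by
  have h := ((cktSize_const ι false).pair (cktSize_const ι true)).outMap
    (fun l : Fin n => if c.testBit l then (Sum.inr () : Unit ⊕ Unit) else Sum.inl ())
  refine h.congr fun x l => ?_
  dsimp only [lowBits]
  cases c.testBit l <;> simp

/-- An input block `win : Fin K → ι`, read as an `n`-bit register (zero-extended if `K ≤ n`,
truncated otherwise), costs one gate (a constant `0` for the padding). -/
theorem cktSize_lowBits_input (n : ℕ) {K : ℕ} (win : Fin K → ι) :
    CktSize B2 (lowBits n fun x => Nat.ofBits fun w => x (win w)) 1 := by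
  have h := ((cktSize_const ι false).pair (CktSize.id B2)).outMap
    (fun l : Fin n => if hl : (l : ℕ) < K then (Sum.inr (win ⟨l, hl⟩) : Unit ⊕ ι) else Sum.inl ())
  refine (h.of_le (by norm_num)).congr fun x l => ?_
  dsimp only [lowBits]
  by_cases hl : (l : ℕ) < K
  · rw [dif_pos hl]
    simp only [Sum.elim_inr]
    exact (Nat.testBit_ofBits_lt (fun w => x (win w)) l hl).symm
  · rw [dif_neg hl]
    simp only [Sum.elim_inl]
    symm
    exact Nat.testBit_lt_two_pow
      ((Nat.ofBits_lt_two_pow _).trans_le (Nat.pow_le_pow_right (by norm_num) (not_lt.1 hl)))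

/-- A single input bit, read as an `n`-bit register (value `0` or `1`), costs one gate. -/
theorem cktSize_lowBits_bit (n : ℕ) (cin : ι) :
    CktSize B2 (lowBits n fun x => (x cin).toNat) 1 := by
  refine cktSize_lowBits_congr (cktSize_lowBits_input n (K := 1) fun _ => cin) fun x => ?_
  rw [Literature.Computability.AlgebraicComplexity.BoolGadgets.ofBits_eq_sum]
  simp

/-! ### The multiply–add block `a · b + d (mod 2ⁿ)` -/

/-- Wires of the multiply–add block: three `n`-bit registers `a`, `b`, `d`. -/
abbrev MAW (n : ℕ) : Type := Fin n ⊕ (Fin n ⊕ Fin n)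

/-- The multiply–add map on bit vectors: bit `l < n` of `a · b + d`. -/
def maFn (n : ℕ) (y : MAW n → Bool) (l : Fin n) : Bool :=
  (Nat.ofBits (fun j => y (Sum.inl j)) * Nat.ofBits (fun j => y (Sum.inr (Sum.inl j))) +
      Nat.ofBits (fun j => y (Sum.inr (Sum.inr j)))).testBit l

/-- Gate budget of the multiply–add block: one schoolbook multiplier and one ripple-carry adder
of width `n`. -/
def maSize (n : ℕ) : ℕ := (n * mulStepSize n + 1) + addSize n

/-- **The multiply–add block** by a `B₂`-circuit of size `maSize n` (Vollmer 1999, §1.1 and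
§1.3.2: school addition and multiplication; only the low `n` bits are kept). -/
theorem cktSize_maFn (n : ℕ) : CktSize B2 (maFn n) (maSize n) := by
  -- stage 1: the low `n` bits of the product `a · b`, and `d` passed through
  have hmul : CktSize B2 (fun (y : MAW n → Bool) (l : Fin n) =>
      mulBits n (fun v => y (Sum.elim Sum.inl (Sum.inr ∘ Sum.inl) v)) (Fin.castAdd n l))
      (n * mulStepSize n + 1) :=
    ((cktSize_mulBits n).rewire (Sum.elim Sum.inl (Sum.inr ∘ Sum.inl))).outMap (Fin.castAdd n)
  have h1 := hmul.pair (CktSize.proj B2 fun j : Fin n => (Sum.inr (Sum.inr j) : MAW n))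
  -- stage 2: add `d`, keep the low `n` bits
  have h2 := h1.comp ((cktSize_addBits n).outMap Fin.castSucc)
  refine (h2.of_le (by simp [maSize])).congr fun y l => ?_
  simp only [addBits, bitsOf, addVal, maFn, Sum.elim_inl, Sum.elim_inr, Fin.val_castSucc]
  have hprod : (Nat.ofBits fun i : Fin n =>
      mulBits n (fun v => y (Sum.elim Sum.inl (Sum.inr ∘ Sum.inl) v)) (Fin.castAdd n i)) =
      (Nat.ofBits (fun j => y (Sum.inl j)) * Nat.ofBits (fun j => y (Sum.inr (Sum.inl j)))) %
        2 ^ n := by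
    simp only [mulBits, bitsOf, Fin.val_castAdd]
    rw [Nat.ofBits_testBit]
    rfl
  rw [hprod]
  exact testBit_eq_of_modEq ((Nat.mod_modEq _ _).add_right _) l.isLt

/-- **Registers are closed under `a · b + d`** at the cost of one multiply–add block. -/
theorem cktSize_lowBits_ma {n sA sB sD : ℕ} {A B D : (ι → Bool) → ℕ}
    (hA : CktSize B2 (lowBits n A) sA) (hB : CktSize B2 (lowBits n B) sB)
    (hD : CktSize B2 (lowBits n D) sD) :
    CktSize B2 (lowBits n fun x => A x * B x + D x) (sA + (sB + sD) + maSize n) := by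
  have h := (hA.pair (hB.pair hD)).comp (cktSize_maFn n)
  refine h.congr fun x l => ?_
  simp only [maFn, Sum.elim_inl, Sum.elim_inr, lowBits]
  rw [Nat.ofBits_testBit, Nat.ofBits_testBit, Nat.ofBits_testBit]
  exact testBit_eq_of_modEq
    (((Nat.mod_modEq _ _).mul (Nat.mod_modEq _ _)).add (Nat.mod_modEq _ _)) l.isLt

/-- **Horner's rule**: the geometric sums `Σ_{k<t} Y^k` of a register `Y` cost `t` multiply–add
blocks (`Σ_{k<t+1} Y^k = Y · Σ_{k<t} Y^k + 1`). -/
theorem cktSize_lowBits_geomSum {n sY : ℕ} {Y : (ι → Bool) → ℕ}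
    (hY : CktSize B2 (lowBits n Y) sY) :
    ∀ t : ℕ, CktSize B2 (lowBits n fun x => ∑ k ∈ Finset.range t, Y x ^ k)
      (2 + t * (sY + 4 + maSize n))
  | 0 => cktSize_lowBits_congr ((cktSize_lowBits_const ι n 0).of_le (by omega)) fun x => by simp
  | t + 1 => by
    have h := cktSize_lowBits_ma hY (cktSize_lowBits_geomSum hY t) (cktSize_lowBits_const ι n 1)
    refine cktSize_lowBits_congr (h.of_le ?_) fun x => ?_
    · rw [Nat.succ_mul]
      omega
    · rw [Finset.sum_range_succ', pow_zero, Finset.mul_sum]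
      simp only [pow_succ']

/-! ### The exponents of the binomial curve -/

/-- The exponent `E_m(j) = Σ_{k ≤ h} (j · (2m+2)^{h+1})^k`, `h = ⌊log₂ m⌋²`, of the route's
binomial curve `x ↦ (x^{E(2i+1)} + x^{E(2i+2)})_{i<m}` (a carry-free power-sum family). -/
def expo (m j : ℕ) : ℕ :=
  ∑ k ∈ Finset.range (Nat.log 2 m ^ 2 + 1), (j * (2 * m + 2) ^ (Nat.log 2 m ^ 2 + 1)) ^ k

/-- The index `j = 2 i + 1 + c` from the bit block `Sum.inl` of `i` and the selector bit
`Sum.inr 0`, as an `n`-bit register: two multiply–add blocks. -/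
theorem cktSize_lowBits_index (n K : ℕ) :
    CktSize B2 (lowBits n fun x : Fin K ⊕ Fin 1 → Bool =>
      2 * Nat.ofBits (fun w => x (Sum.inl w)) + 1 + (x (Sum.inr 0)).toNat) (8 + 2 * maSize n) := by
  have hJ := cktSize_lowBits_ma (cktSize_lowBits_input n (Sum.inl : Fin K → Fin K ⊕ Fin 1))
    (cktSize_lowBits_const (Fin K ⊕ Fin 1) n 2) (cktSize_lowBits_const (Fin K ⊕ Fin 1) n 1)
  have hJ' := cktSize_lowBits_ma (cktSize_lowBits_bit n (Sum.inr 0 : Fin K ⊕ Fin 1))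
    (cktSize_lowBits_const (Fin K ⊕ Fin 1) n 1) hJ
  refine cktSize_lowBits_congr (hJ'.of_le (le_of_eq (by ring))) fun x => ?_
  ring

/-- `Y = j · M` with `M = (2m+2)^{h+1}`: one more multiply–add block. -/
theorem cktSize_lowBits_base (m n K : ℕ) :
    CktSize B2 (lowBits n fun x : Fin K ⊕ Fin 1 → Bool =>
      (2 * Nat.ofBits (fun w => x (Sum.inl w)) + 1 + (x (Sum.inr 0)).toNat) *
        (2 * m + 2) ^ (Nat.log 2 m ^ 2 + 1)) (12 + 3 * maSize n) := by
  have h := cktSize_lowBits_ma (cktSize_lowBits_index n K)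
    (cktSize_lowBits_const (Fin K ⊕ Fin 1) n ((2 * m + 2) ^ (Nat.log 2 m ^ 2 + 1)))
    (cktSize_lowBits_const (Fin K ⊕ Fin 1) n 0)
  refine cktSize_lowBits_congr (h.of_le (le_of_eq (by ring))) fun x => ?_
  ring

/-- Gate budget of the exponent circuit. -/
def expSize (m n : ℕ) : ℕ := 2 + (Nat.log 2 m ^ 2 + 1) * ((12 + 3 * maSize n) + 4 + maSize n)

/-- **The exponent bits by a polynomial-size circuit**: the low `n` bits of `E_m(2i+1+c)` are
computed from the bits of `i` (block `Sum.inl`) and the selector bit `c` (input `Sum.inr 0`)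
by a `B₂`-circuit with `expSize m n` gates (Horner's rule on `Σ_{k ≤ h} (jM)^k`, school
arithmetic mod `2ⁿ`). This is the Boolean-complexity content of "the binomial family is
explicit" (Raz 2010, remark after Def. 1.3). -/
theorem cktSize_lowBits_expo (m n K : ℕ) :
    CktSize B2 (lowBits n fun x : Fin K ⊕ Fin 1 → Bool =>
      expo m (2 * Nat.ofBits (fun w => x (Sum.inl w)) + 1 + (x (Sum.inr 0)).toNat))
      (expSize m n) :=
  cktSize_lowBits_geomSum (cktSize_lowBits_base m n K) (Nat.log 2 m ^ 2 + 1)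

/-- The multiply–add block has `148 n² + 74 n + 2` gates. -/
theorem maSize_eq (n : ℕ) : maSize n = 148 * n ^ 2 + 74 * n + 2 := by
  simp only [maSize, mulStepSize, addSize]
  ring

/-- A polynomial bound for the exponent circuit: `expSize m n ≤ 2400 (⌊log₂ m⌋² + 1) (n+1)²`. -/
theorem expSize_le (m n : ℕ) :
    expSize m n ≤ 2400 * (Nat.log 2 m ^ 2 + 1) * (n + 1) ^ 2 := by
  have hB : 1 ≤ (n + 1) ^ 2 := Nat.one_le_pow _ _ (Nat.succ_pos n)
  have hma : maSize n ≤ 148 * (n + 1) ^ 2 := by rw [maSize_eq]; nlinarith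
  have h1 : (12 + 3 * maSize n) + 4 + maSize n ≤ 608 * (n + 1) ^ 2 := by omega
  have hAB : 1 ≤ (Nat.log 2 m ^ 2 + 1) * (n + 1) ^ 2 := Nat.one_le_iff_ne_zero.2 (by positivity)
  unfold expSize
  calc 2 + (Nat.log 2 m ^ 2 + 1) * ((12 + 3 * maSize n) + 4 + maSize n)
      ≤ 2 + (Nat.log 2 m ^ 2 + 1) * (608 * (n + 1) ^ 2) :=
        Nat.add_le_add_left (Nat.mul_le_mul_left _ h1) _
    _ = 2 + 608 * ((Nat.log 2 m ^ 2 + 1) * (n + 1) ^ 2) := by ring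
    _ ≤ 2400 * ((Nat.log 2 m ^ 2 + 1) * (n + 1) ^ 2) := by omega
    _ = 2400 * (Nat.log 2 m ^ 2 + 1) * (n + 1) ^ 2 := by ring

/-! ### The re-indexed curve family (definitions used by the assembly file) -/

/-- Raz's basic parameter `n` versus the arity: `m(n) = 2^{⌊log₂ n⌋²}` (so `n = m^{o(1)}` and
`m ≥ n^{ω(1)}`). -/
def mFn (n : ℕ) : ℕ := 2 ^ (Nat.log 2 n ^ 2)

/-- The route's binomial curve at arity `m(n)`, as polynomials in one variable over `ℂ`:
`curve n i = x^{E(2i+1)} + x^{E(2i+2)}` with `E = expo (mFn n)`. -/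
noncomputable def curve (n : ℕ) (i : Fin (mFn n)) : MvPolynomial (Fin 1) ℂ :=
  MvPolynomial.X 0 ^ expo (mFn n) (2 * i + 1) + MvPolynomial.X 0 ^ expo (mFn n) (2 * i + 2)

/-- The exponent bit-vectors of the curve as a Boolean map: from the bits of `i` (block
`Sum.inl`, `⌈log₂ m(n)⌉` of them) and one selector bit `c`, the low `n` bits of
`E_{m(n)}(2i+1+c)` (computed by the circuit of `cktSize_lowBits_expo`). -/
def expBits (n : ℕ) : (Fin (Nat.clog 2 (mFn n)) ⊕ Fin 1 → Bool) → Fin n → Bool :=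
  lowBits n fun x =>
    expo (mFn n) (2 * Nat.ofBits (fun w => x (Sum.inl w)) + 1 + (x (Sum.inr 0)).toNat)

end Summit.ValiantsHypothesis.ValiantsHypothesis.Theorems.BinomialElusiveRazTransfer
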